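import Mathlib
import HarnessLib
import Summits.ResolutionOfSingularities.ResolutionOfSingularities.Theorems.WildQuotientsWildQuotientResolutionS1aKillGlue

/-!
# S1a — GLUING AGREEING PRINCIPAL CHARTS WITHOUT A BADNESS HYPOTHESIS: a principal centre with support INSIDE `B`

[OURS · L1 W4.5c · lead-1 g10; FRAME-STATUS rev11 (F6)] — NOT statements of the manuscript; counted 0; AI-level work, weaker than expert review. Crux
stmt-ResolutionOfSingularities-17941 `CyclicQuotientFourfolds`, line `s1a-logminvertex` v10, K-side. Route-independent.

`KillGlue.exists_isPrincipalCentre_of_agree` (p623915) uses `B ⊆ Z(M)` ONLY to prove `B ⊆ supp` (through G1). Dropping it (and the Noetherian base) still gives a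
PRINCIPAL CENTRE — a legal kill move — with support `⊆ B` and every `Oᵢ` a principal-centre chart. This is the form usable at EXPLICIT models, where «`B` is
bad» is a hard negative statement about the invariant ring while the certificate side is pure algebra.
* ★★ `exists_isPrincipalCentre_of_agree_supp_le` — agreeing principal-centre charts covering a closed `G`-compatible `B` with `supp (𝒦ᵢ)_d ∩ Oᵢ ⊆ B` ⇒
  `∃ J, IsPrincipalCentre p M.act g₀ J d ∧ supp J_d ⊆ B ∧ ∀ i, IsPrincipalCentreChart p M.act g₀ J d (O i)`.
-/

set_option linter.dupNamespace false

noncomputable section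

universe u

open CategoryTheory Limits AlgebraicGeometry TopologicalSpace Topology Opposite
open Literature.AlgebraicGeometry.Resolution Literature.AlgebraicGeometry.RelativeSpec
open Summit.ResolutionOfSingularities.ResolutionOfSingularities.Theorems.WildQuotientResolution.S1
open Summit.ResolutionOfSingularities.ResolutionOfSingularities.Theorems.WildQuotientResolution.S1.NodeAtlas
open Summit.ResolutionOfSingularities.ResolutionOfSingularities.Theorems.WildQuotientResolution.S1.BlowupCharts
open Summit.ResolutionOfSingularities.ResolutionOfSingularities.Theorems.WildQuotientResolution.S1.KillFamily
open Summit.ResolutionOfSingularities.ResolutionOfSingularities.Theorems.WildQuotientResolution.S1.CentreGluing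
open Summit.ResolutionOfSingularities.ResolutionOfSingularities.Theorems.WildQuotientResolution.S1.ExtendRees
open Summit.ResolutionOfSingularities.ResolutionOfSingularities.Theorems.WildQuotientResolution.S1.NodeChartAway
open Summit.ResolutionOfSingularities.ResolutionOfSingularities.Theorems.WildQuotientResolution.S1.KillGlue

namespace Summit.ResolutionOfSingularities.ResolutionOfSingularities.Theorems.WildQuotientResolution.S1.KillGlue

variable {p : ℕ} {X' X₁ : Scheme.{0}} {q : X' ⟶ X₁} {G : Type} [Group G] {ρ : G →* Aut X'} {g₀ : G}

/-- ★★ **AGREEING PRINCIPAL CHARTS GLUE TO A PRINCIPAL CENTRE WITH SUPPORT INSIDE `B`** — no badness of `B`, no Noetherian base needed (those enter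
`exists_isPrincipalCentre_of_agree` only for `B ⊆ supp`). [OURS · L1 W4.5c; NOT a statement of the manuscript] -/
theorem exists_isPrincipalCentre_of_agree_supp_le [Finite G] (hG : ∀ g : G, g ∈ Subgroup.zpowers g₀) (M : GameFrame.GModel p q G ρ g₀)
    [M.V.IsSeparated] {ι : Type} [Finite ι]
    (O : ι → M.act.StableAffineOpens) (𝒦 : ι → ReesFiltration M.V) {d : ℕ} (hd : 0 < d)
    (hprin : ∀ i, IsPrincipalCentreChart p M.act g₀ (𝒦 i) d (O i))
    (hagree : ∀ i k (U : M.V.affineOpens), U.1 ≤ (O i).1 → U.1 ≤ (O k).1 → ∀ n, ((𝒦 i).filtration U).ideal n = ((𝒦 k).filtration U).ideal n)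
    {B : Set M.V} (hBc : IsClosed B) (hBcov : B ⊆ ⋃ i, ((O i).1 : Set M.V))
    (hsupp : ∀ i, (((𝒦 i).ideal d).support : Set M.V) ∩ (O i).1 ⊆ B) :
    ∃ J : ReesFiltration M.V, IsPrincipalCentre p M.act g₀ J d ∧ (((J.ideal d).support : Set M.V) ⊆ B) ∧
      ∀ i, IsPrincipalCentreChart p M.act g₀ J d (O i) := by
  haveI : IsLocallyNoetherian M.V := M.isLocallyNoetherian
  let J : ReesFiltration M.V := glue M.act O 𝒦
  have hJO : ∀ i, IsPrincipalCentreChart p M.act g₀ J d (O i) := fun i =>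
    isPrincipalCentreChart_congr (hprin i) fun hO n => filtration_glue_eq O 𝒦 (fun i => (hprin i).1) hagree i n
  have hGst : ∀ (g : G) (n : ℕ), (J.ideal n).comap (M.act.aut g).hom = J.ideal n := comap_aut_glue hG O 𝒦 hprin
  have hsub : ((J.ideal d).support : Set M.V) ⊆ B := by
    refine (support_glue_subset (ρ := M.act) O 𝒦 d).trans (Set.iUnion_subset fun i => ?_)
    exact closure_minimal (hsupp i) hBc
  refine ⟨J, ⟨hd, hGst, fun v => ?_⟩, hsub, hJO⟩
  by_cases hv : v ∈ ((J.ideal d).support : Set M.V)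
  · obtain ⟨i, hvi⟩ := Set.mem_iUnion.mp (hBcov (hsub hv))
    exact ⟨O i, hvi, Or.inl (hJO i)⟩
  · obtain ⟨O₀, hvO₀, hn⟩ := M.atlas v
    obtain ⟨O'', hvO'', -, hO''W, hn''⟩ := exists_isNodeChart_le hn hvO₀ (J.ideal d).support.compl
      (preimage_support_compl M.act (fun g => hGst g d)) hv
    refine ⟨O'', hvO'', Or.inr ⟨hn'', fun n => filtration_eq_top_of_disjoint _ hd ⟨O''.1, hn''.1⟩ ?_ n⟩⟩
    rw [Set.disjoint_left]
    intro x hx hx'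
    exact hO''W hx hx'

end Summit.ResolutionOfSingularities.ResolutionOfSingularities.Theorems.WildQuotientResolution.S1.KillGlue

end
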